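import Summits.BirchSwinnertonDyer.BirchSwinnertonDyer.Theorems.SignedLowerHalvesSmallImageLowerHalfBothSignsRttCharRoadE2TwistSpecialisation
import HarnessLib

/-!
# Route `SignedLowerHalves`, crux L `SmallImageLowerHalfBothSigns` (stmt-BirchSwinnertonDyer-23599), line `rtt_w3` v13 — E2, row D2 / E2K_alg (BRIEF-E2 rev 2.1 §6),
# LEAD: THE TWO MODEL CASES OF THE SPECIALISATION LEMMA ALONG `f = (1+T₂) − u` — `Λ₂/(g, f) ≅ Λ/(φ_u g)` AND `(Λ₂/(g))[f] = 0`

WHY: the junction of the E2-K descent («detdescent» E2K_alg; LEAD ruling §6) is the specialisation lemma along the principal height-one prime `f = (1+T₂) − u` of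
`Λ₂ = ℤ_p⟦T₂⟧⟦T₁⟧`: in `λ`-currency, `λ_Λ(M/fM) − λ_Λ(M[f]) = d(φ_u(char M))` for f.g. torsion `M`, by dévissage over a prime filtration. This file proves the two
MODEL CASES at a cyclic module `M = Λ₂/(g)`, at ring level (no choice of `Λ`-module structure enters): for the twist specialisation `φ_u : Λ₂ ↠ Λ` with `ker φ_u = (f)`
(`exists_twistSpecialisation`, p774681) — (1) `Λ₂/(g, f) ≃+* Λ/(φ_u g)` (so `M/fM` is the cyclic `Λ`-module on the specialised series `φ_u g`), and (2) if `φ_u g ≠ 0`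
then `f` is a non-zero-divisor modulo `g`: `(Λ₂/(g))[f] = 0` (`f` is prime since `(f) = ker φ_u` with `Λ` a domain, and `f ∤ g`). Both are stated for an arbitrary
surjection of commutative rings with principal kernel (§1) and then specialised (§2). THEOREMS ONLY; nothing about `BirchSwinnertonDyer`, crux L or E2 is proved here.
[cite: Washington1997, §7.1, §13.2] [cite: JohnsonLeungKings2011, §4.2, Lemma 4.4, Cor. 5.3] [cite: BourbakiAC5to7, VII §3 no. 8]
-/

set_option linter.dupNamespace false -- D-0017: single-problem summit, the namespace repeats the problem name by design

noncomputable section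

open scoped Classical

namespace Summit.BirchSwinnertonDyer.BirchSwinnertonDyer.Theorems.SmallImageCharSignedSelmer

open PowerSeries Literature.NumberTheory.EllipticCurves

/-! ## §1 Generic: a surjection with principal kernel -/

section Generic

variable {R S : Type*} [CommRing R] [CommRing S] (φ : R →+* S)

/-- **`R/(g, f) ≅ S/(φ g)`** for a surjection `φ : R ↠ S` with `ker φ = (f)`: the composite `R → S → S/(φ g)` is onto with kernel `φ⁻¹((φ g)) = (g) + (f)`.
[cite: BourbakiAC5to7, VII §3 no. 8] -/
theorem nonempty_ringEquiv_quotient_pair (hφ : Function.Surjective φ) {f : R} (hker : RingHom.ker φ = Ideal.span {f}) (g : R) :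
    Nonempty ((R ⧸ Ideal.span {g, f}) ≃+* (S ⧸ Ideal.span {φ g})) := by
  set ψ : R →+* S ⧸ Ideal.span {φ g} := (Ideal.Quotient.mk (Ideal.span {φ g})).comp φ with hψdef
  have hψ : Function.Surjective ψ := Ideal.Quotient.mk_surjective.comp hφ
  have hkerψ : RingHom.ker ψ = Ideal.span {g, f} := by
    rw [hψdef, ← RingHom.comap_ker, Ideal.mk_ker,
      show Ideal.span {φ g} = Ideal.map φ (Ideal.span {g}) by rw [Ideal.map_span, Set.image_singleton],
      Ideal.comap_map_of_surjective φ hφ, ← RingHom.ker_eq_comap_bot, hker, Ideal.span_insert]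
  exact ⟨(Ideal.quotEquivOfEq hkerψ.symm).trans (RingHom.quotientKerEquivOfSurjective hψ)⟩

/-- **`f` prime with `f ∤ g` is a non-zero-divisor modulo `g`** (domain `R`): the `f`-torsion of `R/(g)` vanishes — from `f y = g z`, `f ∣ z` and cancelling `f`
gives `g ∣ y`. [cite: BourbakiAC5to7, VII §3 no. 8] -/
theorem torsionBy_quotient_span_eq_bot [IsDomain R] {f g : R} (hf : Prime f) (hfg : ¬ f ∣ g) :
    Submodule.torsionBy R (R ⧸ Ideal.span {g}) f = ⊥ := by
  rw [eq_bot_iff]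
  intro x hx
  rw [Submodule.mem_torsionBy_iff] at hx
  obtain ⟨y, rfl⟩ := Ideal.Quotient.mk_surjective x
  rw [Submodule.mem_bot, Ideal.Quotient.eq_zero_iff_mem, Ideal.mem_span_singleton]
  have hfy : f * y ∈ Ideal.span {g} := by
    rw [← Ideal.Quotient.eq_zero_iff_mem, map_mul, ← Ideal.Quotient.algebraMap_eq, ← Algebra.smul_def]
    exact hx
  obtain ⟨z, hz⟩ := Ideal.mem_span_singleton'.1 hfy
  -- `z * g = f * y`
  have hfz : f ∣ z := by
    rcases hf.dvd_or_dvd (⟨y, by rw [hz]⟩ : f ∣ z * g) with h | h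
    · exact h
    · exact absurd h hfg
  obtain ⟨z', rfl⟩ := hfz
  refine ⟨z', mul_left_cancel₀ hf.ne_zero ?_⟩
  rw [← hz]
  ring

end Generic

/-! ## §2 The model cases along `f = (1+T₂) − u` -/

section Twist

variable {p : ℕ} [Fact p.Prime] (u : ℤ_[p]) (φ : IwasawaAlgebra₂ p →+* IwasawaAlgebra p) (hφ : Function.Surjective φ)
  (hker : RingHom.ker φ = Ideal.span {1 + (C (X : IwasawaAlgebra p) : IwasawaAlgebra₂ p) - C (C u)})

/-- `(1+T₂) − u = C (X − C (u−1))` is non-zero in `Λ₂`. [folklore] -/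
theorem one_add_CX_sub_CC_ne_zero : (1 + (C (X : IwasawaAlgebra p) : IwasawaAlgebra₂ p) - C (C u)) ≠ 0 := by
  have hgen : (1 + (C (X : IwasawaAlgebra p) : IwasawaAlgebra₂ p) - C (C u)) = C (X - C (u - 1)) := by
    rw [map_sub, map_sub, map_sub, map_one, map_one]
    ring
  rw [hgen, Ne, map_eq_zero_iff C (C_injective), sub_eq_zero]
  intro h
  have h1 := congrArg (coeff 1) h
  rw [coeff_one_X, coeff_C, if_neg one_ne_zero] at h1
  exact one_ne_zero h1

include hφ hker in
/-- ★ **Model case (1): `Λ₂/(g, f) ≅ Λ/(φ_u g)`** for the twist specialisation `φ_u` (`f = (1+T₂) − u`, `ker φ_u = (f)`). [cite: JohnsonLeungKings2011, §4.2, Lemma 4.4]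
[cite: Washington1997, §7.1] -/
theorem nonempty_ringEquiv_quotient_twist (g : IwasawaAlgebra₂ p) :
    Nonempty ((IwasawaAlgebra₂ p ⧸ Ideal.span {g, 1 + (C (X : IwasawaAlgebra p) : IwasawaAlgebra₂ p) - C (C u)}) ≃+*
      (IwasawaAlgebra p ⧸ Ideal.span {φ g})) :=
  nonempty_ringEquiv_quotient_pair φ hφ hker g

include hker in
/-- `f = (1+T₂) − u` is prime in `Λ₂` (its ideal is the kernel of a surjection onto the domain `Λ`). [cite: Washington1997, §7.1] -/
theorem prime_one_add_CX_sub_CC : Prime (1 + (C (X : IwasawaAlgebra p) : IwasawaAlgebra₂ p) - C (C u)) := by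
  rw [← Ideal.span_singleton_prime (one_add_CX_sub_CC_ne_zero u), ← hker]
  exact RingHom.ker_isPrime φ

include hker in
/-- ★ **Model case (2): `(Λ₂/(g))[f] = 0` when `φ_u g ≠ 0`** (`f = (1+T₂) − u` is prime and does not divide `g`). [cite: JohnsonLeungKings2011, §4.2, Lemma 4.4]
[cite: Washington1997, §13.2] -/
theorem torsionBy_quotient_twist_eq_bot (g : IwasawaAlgebra₂ p) (hg : φ g ≠ 0) :
    Submodule.torsionBy (IwasawaAlgebra₂ p) (IwasawaAlgebra₂ p ⧸ Ideal.span {g})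
      (1 + (C (X : IwasawaAlgebra p) : IwasawaAlgebra₂ p) - C (C u)) = ⊥ := by
  refine torsionBy_quotient_span_eq_bot (prime_one_add_CX_sub_CC u φ hker) fun h ↦ hg ?_
  have hmem : g ∈ RingHom.ker φ := by
    rw [hker, Ideal.mem_span_singleton]
    exact h
  exact hmem

end Twist

end Summit.BirchSwinnertonDyer.BirchSwinnertonDyer.Theorems.SmallImageCharSignedSelmer

end
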